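import Summits.QuantumFields.YangMills.Theorems.BalabanUVNodesN19AdditiveLinksMomentFirstOrder
import Summits.QuantumFields.YangMills.Theorems.BalabanUVNodesN19LipschitzLinksMomentBudget

/-!
# YM-DAG node N19 (= NE7 proper) — EVERY LIPSCHITZ LINK OF EVERY ADDITIVE LIPSCHITZ STATISTIC IN THE UNIFORM MIXED-MOMENT CURRENCY
# (laws with `e^{−L}`-close mixed moments: `|∫h(Σ_iφ_i(x_i))dP − ∫h(Σ_iφ_i(x_i))dQ| ≤ 1.2·10⁵·K·d·log₂³L∕L` — CURRENCY-MAP v7's composition class)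

Cell `pub-ymgap`, HUMAN RULING D-0062 (Track A) ∕ D-0149 (work-bound push), R141 (C) wider-strategy seat `pub-ymgap-dag-n19-e` (strategy
s3 = ALTERNATIVE CURRENCY), generation g33, module 16 (lineage module 163).  Route `Summits/QuantumFields/YangMills/Theses/BalabanUVNodes.lean`,
cluster item K3⁸ «SpineGivenEndpointR13SepCoPHV» (stmt-QuantumFields-27366); filed `--supports` that item `--as helper` (it proves no registered
stub).  COUNT-NEUTRAL: [folklore]∕[bookkeeping] over the lineage BY NAME — module 162 (`exists_mvPolynomial_near_trigLink_additive_firstOrder_mass`),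
module 158 (`additive_mem_Icc`), module 152a (`exists_trigLink_near_lipschitzLink`), module 156 (`logb_sq_le_L`, `exists_parameters_L`, `errorBound_L`),
module 145 (`abs_integral_sub_le_of_near_mass`), module (`integrable_of_continuous_of_cube`); TOY laws under HYPOTHESES; no scheme object, no Theses
import; NOT a discharge claim.

THE RESULT.  CURRENCY-MAP v7's row «UNIFORM MOMENTS `r` → Lipschitz links of Lipschitz one-string observables `h(Σ_iφ_i(x_i))`: TYPED `≲ |ι|∕√L`
(module 111), CONJECTURED `Θ(|ι|·K·K_φ∕L)`».  THIS MODULE: ★★★ `abs_integral_lipschitzLink_additive_sub_le_of_closeMoments` — **for continuous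
`1`-Lipschitz `φ_i : [−1,1] → [0,1]`, probability laws `P, Q` on `ℝ^ι` carried by `[−1,1]^ι` with `|Δ mixed moments| ≤ e^{−L}` (`L ≥ 2^27`), and every
`K`-Lipschitz `h` on `ℝ`: `|∫h(Σ_iφ_i(x_i))dP − ∫h(Σ_iφ_i(x_i))dQ| ≤ 1.2·10⁵·K·d·(log₂L)³∕L`** — the conjectured ridge rate up to `log³L`, uniformly in
`d` (general `K_φ`-Lipschitz `G_φ`-bounded `φ_i` by the affine rescaling of module 160: `× 2max(K_φ, G_φ)`).  The proof is module 156's with module 162's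
polynomial; module 156's parameters and bookkeeping are used BY NAME.

HONEST FRAMING (binding).  Elementary and [folklore]; TOY laws under hypotheses; constants astronomical; NO consumer in the DAG today (the seat's own
currency map); nothing of Bałaban's instantiated; NE7 NOT PRINTED, NOT proved; N19 NOT discharged; count-neutral.  One finite `T⁴` programme at fixed
`ε`; nothing continuum ∕ `ℝ⁴` ∕ OS ∕ mass-gap ∕ Clay.  0 `def` ∕ 0 `sorry`.
-/

noncomputable section

open Finset MeasureTheory
open scoped Real

namespace Summit.QuantumFields.YangMills.Theorems.BalabanUVNodesN19AdditiveLinksMomentBudget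

open Summit.QuantumFields.YangMills.Theorems.BalabanUVNodesN19AdditiveLinksMomentFirstOrder
  (exists_mvPolynomial_near_trigLink_additive_firstOrder_mass)
open Summit.QuantumFields.YangMills.Theorems.BalabanUVNodesN19AdditiveLinksLadder (additive_mem_Icc)
open Summit.QuantumFields.YangMills.Theorems.BalabanUVNodesN19LipschitzLinkTrigSmoothing (exists_trigLink_near_lipschitzLink)
open Summit.QuantumFields.YangMills.Theorems.BalabanUVNodesN19LipschitzLinksMomentBudget (logb_sq_le_L exists_parameters_L errorBound_L)
open Summit.QuantumFields.YangMills.Theorems.BalabanUVNodesN19SingleModeMomentLogFreeBudget (abs_integral_sub_le_of_near_mass)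
open Summit.QuantumFields.YangMills.Theorems.BalabanUVNodesN19JointLawBernstein (integrable_of_continuous_of_cube)

variable {ι : Type*} [Fintype ι] [Nonempty ι]
variable {φ : ι → ℝ → ℝ}
  (hφL : ∀ i, ∀ u v : ℝ, u ∈ Set.Icc (-1 : ℝ) 1 → v ∈ Set.Icc (-1 : ℝ) 1 → |φ i u - φ i v| ≤ 1 * |u - v|)
  (hφ0 : ∀ i, ∀ u : ℝ, u ∈ Set.Icc (-1 : ℝ) 1 → 0 ≤ φ i u) (hφ1 : ∀ i, ∀ u : ℝ, u ∈ Set.Icc (-1 : ℝ) 1 → φ i u ≤ 1)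

/-! ## §3 ★★★ Every Lipschitz link in the uniform mixed-moment currency [folklore] -/


include hφL hφ0 hφ1 in
/-- ★★★ **EVERY LIPSCHITZ LINK OF EVERY ADDITIVE LIPSCHITZ STATISTIC, IN THE UNIFORM MIXED-MOMENT CURRENCY, AT THE RIDGE RATE UP TO `log³`.**  Let `φ_i : ℝ → ℝ` be CONTINUOUS, `1`-Lipschitz with values in `[0,1]` on `[−1,1]`.   Let `P, Q`
be probability laws on `ℝ^ι` carried by `[−1,1]^ι` (finite nonempty `ι`, `d = |ι|`) with `|∫∏x_i^{j_i}dP − ∫∏x_i^{j_i}dQ| ≤ e^{−L}` for every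
multi-index `j`, `L ≥ 2^27`, and let `h : ℝ → ℝ` satisfy `|h(s) − h(s′)| ≤ K|s − s′|` on `ℝ` (`K ≥ 0`).  Then
**`|∫h(Σ_iφ_i(x_i))dP − ∫h(Σ_iφ_i(x_i))dQ| ≤ 1.2·10⁵·K·d·(log₂L)³∕L`** (module 156 verbatim with modules 161∕162).  PROOF: `h(S) − h(0)` (the constant integrates to zero difference); §1's parameters;
module 152a's smoothing `g` at Fejér order `L_F`; module 155's polynomial with mass `≤ 2L_FKd·e^{Λ}(1 + 2aN9^N) ≤ 2L_FKd·e^{L∕2}`; module 145's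
price `2·sup + mass·e^{−L}` with §2's sup bookkeeping and `2LKd·e^{−L∕2} ≤ 16Kd∕L`.  READING (CURRENCY-MAP v7 conjecture, `φ = |·|`): under UNIFORM
mixed-moment closeness `r` the Lipschitz links of `Σ_i|x_i|` converge at `≍ d·K∕log r⁻¹` up to `log³` — the ridge rate, against module 111's
`d∕√(log r⁻¹)`; two-sided by module 138 (`sin(ωΣ|x_i|)`) ∕ module 66 (`Σ|x_i|`). [folklore] -/
theorem abs_integral_lipschitzLink_additive_sub_le_of_closeMoments {P Q : Measure (ι → ℝ)} [IsProbabilityMeasure P] [IsProbabilityMeasure Q]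
    (hP : P (Set.pi Set.univ (fun _ : ι => Set.Icc (-1 : ℝ) 1))ᶜ = 0) (hQ : Q (Set.pi Set.univ (fun _ : ι => Set.Icc (-1 : ℝ) 1))ᶜ = 0)
    {L : ℝ} (hL : (2 : ℝ) ^ (27 : ℕ) ≤ L) (hmom : ∀ j : ι → ℕ, |∫ x, ∏ i, x i ^ j i ∂P - ∫ x, ∏ i, x i ^ j i ∂Q| ≤ Real.exp (-L))
    (hφc : ∀ i, Continuous (φ i)) {h : ℝ → ℝ} {K : ℝ} (hK0 : 0 ≤ K) (hK : ∀ s s', |h s - h s'| ≤ K * |s - s'|) :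
    |∫ x, h (∑ i, φ i (x i)) ∂P - ∫ x, h (∑ i, φ i (x i)) ∂Q| ≤ 120000 * K * Fintype.card ι * Real.logb 2 L ^ 3 / L := by
  have hTc : Continuous fun x : ι → ℝ => ∑ i, φ i (x i) := continuous_finsetSum _ fun i _ => (hφc i).comp (continuous_apply i)
  set d : ℝ := (Fintype.card ι : ℝ) with hdd
  have hd : 0 < d := by rw [hdd]; exact_mod_cast Fintype.card_pos
  have hL0 : 0 < L := lt_of_lt_of_le (by positivity) hL
  have hLge : (134217728 : ℝ) ≤ L := le_trans (by norm_num) hL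
  obtain ⟨hΛ27, hΛsq⟩ := logb_sq_le_L hL
  obtain ⟨LF, J, hh, N, hLF1, hLLF, hLFL, hh1, hJh, hexph, hJ1, hLππ, hNJ, hJsq, hN17, hbudget⟩ := exists_parameters_L hL
  have hLFr : (1 : ℝ) ≤ LF := by exact_mod_cast hLF1
  have hLFL' : (LF : ℝ) ≤ L := by
    have h1 : (1 : ℝ) ≤ 52000 * Real.logb 2 L ^ 2 := by nlinarith only [hΛ27]
    exact (le_mul_of_one_le_left (by positivity) h1).trans hLFL
  -- the smoothing of the link on `[0, d]`
  have hK' : ∀ s s', s ∈ Set.Icc (0 : ℝ) d → s' ∈ Set.Icc (0 : ℝ) d → |h s - h s'| ≤ K * |s - s'| := fun s s' _ _ => hK s s'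
  obtain ⟨α, β, ω, g, g₁, hω0, hωΩ, hW, hg, hg₁, hC11, hB1, herr⟩ := exists_trigLink_near_lipschitzLink hd hK0 hK' hLF1
  have hΩ : (0 : ℝ) ≤ LF * π / d := by positivity
  -- the polynomial with mass
  obtain ⟨F, hFmass, hFerr⟩ := exists_mvPolynomial_near_trigLink_additive_firstOrder_mass hφL hφ0 hφ1 (range LF ×ˢ range LF) (h 0) α β ω
    (Ω := LF * π / d) (W := 2 * LF * (K * d)) (B₁ := K) (B₂ := K * π * LF / d) hg hg₁ hΩ hω0 hωΩ hW hC11 hB1 J hh N hh1 hJh hNJ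
  -- the sup error on the cube
  have hS := fun (x : ι → ℝ) (hx : ∀ i, x i ∈ Set.Icc (-1 : ℝ) 1) => additive_mem_Icc hφ0 hφ1 x hx
  have hlg : Real.log LF ≤ 0.6932 * Real.logb 2 L := by
    have hlogL : Real.log L = Real.logb 2 L * Real.log 2 := by
      rw [Real.logb, div_mul_cancel₀ _ (Real.log_pos one_lt_two).ne']
    calc Real.log LF ≤ Real.log L := Real.log_le_log (by linarith) hLFL'
      _ ≤ 0.6932 * Real.logb 2 L := by
          rw [hlogL, mul_comm]
          exact mul_le_mul_of_nonneg_right (Real.log_two_lt_d9.trans (by norm_num)).le (by linarith only [hΛ27])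
  have hε : 2 * ((J : ℝ) + 1) * Real.exp (-(hh : ℝ)) ≤ 1 / (2 * L ^ 2) := by
    calc 2 * ((J : ℝ) + 1) * Real.exp (-(hh : ℝ)) ≤ 2 * (L / 4) * (1 / L ^ 3) := by
          have := mul_le_mul hJ1 hexph (Real.exp_pos _).le (by positivity)
          linarith only [this]
      _ = 1 / (2 * L ^ 2) := by field_simp; ring
  have hNJr : ((2 : ℝ) ^ J) ≤ N := by exact_mod_cast hNJ
  have hη := errorBound_L (M := (2 : ℝ) ^ J) (ε := 2 * ((J : ℝ) + 1) * Real.exp (-(hh : ℝ))) hK0 hd hLge hΛ27 hLFr hLFL' hLLF hlg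
    hLππ hNJr hJsq hN17 hε
  have happ : ∀ x : ι → ℝ, (∀ i, x i ∈ Set.Icc (-1 : ℝ) 1) →
      |(h (∑ i, φ i (x i)) - h 0) - MvPolynomial.eval x F| ≤ 58621 * K * d * Real.logb 2 L ^ 3 / L := by
    intro x hx
    have h1 := herr (∑ i, φ i (x i)) (by rw [hdd]; exact ⟨(hS x hx).1, (hS x hx).2⟩)
    have h2 := hFerr x hx
    rw [← hdd] at h2
    calc |(h (∑ i, φ i (x i)) - h 0) - MvPolynomial.eval x F|
        ≤ |h (∑ i, φ i (x i)) - g (∑ i, φ i (x i))| + |(g (∑ i, φ i (x i)) - h 0) - MvPolynomial.eval x F| := by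
          have e : (h (∑ i, φ i (x i)) - h 0) - MvPolynomial.eval x F =
              (h (∑ i, φ i (x i)) - g (∑ i, φ i (x i))) + ((g (∑ i, φ i (x i)) - h 0) - MvPolynomial.eval x F) := by ring
          rw [e]; exact abs_add_le _ _
      _ ≤ _ := add_le_add h1 h2
      _ ≤ 58621 * K * d * Real.logb 2 L ^ 3 / L := hη
  -- the mass budget: `mass F · e^{−L} ≤ 2 L_F K d · e^{−L/2} ≤ 16Kd/L`
  have hmass : (∑ s ∈ F.support, |F.coeff s|) * Real.exp (-L) ≤ 16 * K * d / L := by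
    have hW0 : 0 ≤ 2 * (LF : ℝ) * (K * d) := by positivity
    have e : LF * π / d * (Fintype.card ι : ℝ) = LF * π := by rw [← hdd]; field_simp
    rw [e] at hFmass
    have h1 : (∑ s ∈ F.support, |F.coeff s|) ≤ 2 * LF * (K * d) * Real.exp (L / 2) := by
      refine hFmass.trans ?_
      rw [mul_assoc]
      refine mul_le_mul_of_nonneg_left ?_ hW0
      rw [← Real.exp_log (show (0 : ℝ) < 1 + 2 * (LF * π) * (N * 9 ^ N) by positivity), ← Real.exp_add]
      exact Real.exp_le_exp.2 hbudget
    have h2 : L ^ 2 * Real.exp (-(L / 2)) ≤ 8 := by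
      have h3 : (L / 2) ^ 2 / 2 ≤ Real.exp (L / 2) := by
        have := Real.quadratic_le_exp_of_nonneg (show 0 ≤ L / 2 by positivity)
        linarith
      rw [Real.exp_neg]
      have h4 : 0 < Real.exp (L / 2) := Real.exp_pos _
      rw [mul_inv_le_iff₀ h4]
      nlinarith only [h3]
    calc (∑ s ∈ F.support, |F.coeff s|) * Real.exp (-L) ≤ 2 * LF * (K * d) * Real.exp (L / 2) * Real.exp (-L) :=
          mul_le_mul_of_nonneg_right h1 (Real.exp_pos _).le
      _ = 2 * LF * (K * d) * Real.exp (-(L / 2)) := by rw [mul_assoc, ← Real.exp_add]; ring_nf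
      _ ≤ 2 * L * (K * d) * Real.exp (-(L / 2)) := by
          have := mul_le_mul_of_nonneg_right hLFL' (by positivity : (0 : ℝ) ≤ 2 * (K * d) * Real.exp (-(L / 2)))
          nlinarith only [this]
      _ = 2 * (K * d) / L * (L ^ 2 * Real.exp (-(L / 2))) := by field_simp
      _ ≤ 2 * (K * d) / L * 8 := mul_le_mul_of_nonneg_left h2 (by positivity)
      _ = 16 * K * d / L := by ring
  -- the price
  have hLip : LipschitzWith (Real.toNNReal K) h := by
    refine LipschitzWith.of_dist_le_mul fun x y => ?_
    rw [Real.dist_eq, Real.dist_eq, Real.coe_toNNReal _ hK0]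
    exact hK x y
  have hcont : Continuous fun x : ι → ℝ => h (∑ i, φ i (x i)) := hLip.continuous.comp hTc
  have hg0 : Continuous fun x : ι → ℝ => h (∑ i, φ i (x i)) - h 0 := hcont.sub continuous_const
  have hprice := abs_integral_sub_le_of_near_mass hP hQ (Real.exp_pos _).le hmom hg0 happ le_rfl
  -- the constant integrates to zero difference
  have hconst : ∫ x, h (∑ i, φ i (x i)) ∂P - ∫ x, h (∑ i, φ i (x i)) ∂Q =
      ∫ x, (h (∑ i, φ i (x i)) - h 0) ∂P - ∫ x, (h (∑ i, φ i (x i)) - h 0) ∂Q := by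
    rw [integral_sub (integrable_of_continuous_of_cube hP hcont) (integrable_const _),
      integral_sub (integrable_of_continuous_of_cube hQ hcont) (integrable_const _)]
    simp only [integral_const, smul_eq_mul, probReal_univ]
    ring
  rw [hconst]
  refine hprice.trans ?_
  have hKd : 0 ≤ K * d := mul_nonneg hK0 hd.le
  have hΛ3 : 1 ≤ Real.logb 2 L ^ 3 := one_le_pow₀ (by linarith only [hΛ27])
  have e : 2 * (58621 * K * d * Real.logb 2 L ^ 3 / L) + 16 * K * d / L =
      (117242 * K * d * Real.logb 2 L ^ 3 + 16 * K * d) / L := by ring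
  rw [hdd] at hmass e ⊢
  calc 2 * (58621 * K * (Fintype.card ι : ℝ) * Real.logb 2 L ^ 3 / L) + (∑ s ∈ F.support, |F.coeff s|) * Real.exp (-L)
      ≤ 2 * (58621 * K * (Fintype.card ι : ℝ) * Real.logb 2 L ^ 3 / L) + 16 * K * (Fintype.card ι : ℝ) / L := add_le_add le_rfl hmass
    _ = (117242 * K * (Fintype.card ι : ℝ) * Real.logb 2 L ^ 3 + 16 * K * (Fintype.card ι : ℝ)) / L := e
    _ ≤ 120000 * K * Fintype.card ι * Real.logb 2 L ^ 3 / L := by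
        refine div_le_div_of_nonneg_right ?_ hL0.le
        rw [← hdd]
        nlinarith only [hKd, hΛ3]

end Summit.QuantumFields.YangMills.Theorems.BalabanUVNodesN19AdditiveLinksMomentBudget

end
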